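import Literature.Probability.Percolation.PivotalLowerBoundFromSeparation
import Literature.Probability.Percolation.ParaPivotalSumBounds
import Literature.Probability.Percolation.AltFourArm
import HarnessLib

/-!
# The pivotal lower bound of Lemma 6.2 for a general kernel, and for Werner's alternating `π̂` (proofs only)

Topic `Literature/Probability/Percolation`; family `crit-perc`. PROOFS ONLY (no definition, no
named fact). The tree proves `Werner2009_pivotal_lowerBound` (interior points of `R(2N, N)` are
pivotal for `LR(2N, N)` with probability `≥ c π̂_t(r₀, N)` below `L(t, ε)`) from near-critical
four-arm separation for the ORDER-FREE `π̂` (`Werner2009_pivotal_lowerBound_of_separation`,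
`PivotalLowerBoundFromSeparation.lean`) and sums it (`paraPivotalSum_lower_of_fact`,
`ParaPivotalSumBounds.lean`). Both proofs use of the kernel only (i) the separation hypothesis at
the scales `(r₀, 64q)` and (ii) antitonicity in the outer radius; this file records them for an
arbitrary kernel `X t r R` (`pivotal_lowerBound_of_separation_gen`, `paraPivotalSum_lower_gen`,
proofs verbatim) and specialises to the ALTERNATING kernel `altFourArmProbAt`
(`paraPivotalSum_lower_alt_of_altSeparation`): from ALTERNATING separation
`c · π̂^alt_t(n, N) ≤ P_t(sepFourArm n N)` (Nolin 2008, Thm. 11 for `σ = BWBW`),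
`c' · N² π̂^alt_t(r₀, N) ≤ Σ_{v ∈ R(2N,N)} P_t(v pivotal for LR(2N, N))` below `L(t, ε)` — the input
of the differential-inequality step of Werner's Lemma 6.3 for `π̂^alt`.

## References

* W. Werner, *Lectures on two-dimensional critical percolation*, IAS/Park City Math. Ser. 16
  (2009), Lecture 6, proof of Lemma 6.2 (lower bound) [WernerPCMI2009].
* P. Nolin, Near-critical percolation in two dimensions, *Electron. J. Probab.* 13 (2008), Rem. 9,
  Thm. 11, Prop. 12, Lemma 13, proof of Prop. 32 (arXiv 0711.4948: Rem. 8, Thm. 10, Prop. 11,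
  Lemma 12, Prop. 31) [Nolin2008].
* H. Kesten, Scaling relations for 2D-percolation, *Comm. Math. Phys.* 109 (1987), Lemmas 4–6, 8
  [KestenScalingCMP1987].
-/

noncomputable section

open MeasureTheory unitInterval Set

namespace Literature.Probability.Percolation

open LatticeModels

/-- **The pivotal lower bound from near-critical four-arm separation, general kernel** (the tree's
`Werner2009_pivotal_lowerBound_of_separation` with `fourArmProbAt` replaced by any kernel `X`
antitone in the outer radius; proof verbatim): IF `c · X_t(n, N) ≤ P_t(sepFourArm n N)` for
`n₀ ≤ n`, `2n ≤ N ≤ L(t, ε)`, THEN every site of `R(2N, N)` at distance more than `N/4` from its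
boundary is pivotal for `LR(2N, N)` with probability `≥ c' · X_t(r₀, N)` for `n₁ ≤ N ≤ L(t, ε)`. [cite: WernerPCMI2009, Lecture 6, proof of Lemma 6.2 (lower bound)] [cite: Nolin2008, Rem. 9, Thm. 11, Prop. 12, Lemma 13 and proof of Prop. 32 (arXiv 0711.4948: Rem. 8, Thm. 10, Prop. 11, Lemma 12, Prop. 31)] [cite: KestenScalingCMP1987, Lemmas 4–6 and 8] -/
theorem pivotal_lowerBound_of_separation_gen {X : unitInterval → ℕ → ℕ → ℝ}
    (hXa : ∀ t r R R', r ≤ R → R ≤ R' → X t r R' ≤ X t r R)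
    (hsep : ∃ ε₁ > (0 : ℝ), ∀ ⦃ε : ℝ⦄, 0 < ε → ε < ε₁ →
      ∃ n₀ : ℕ, ∃ δ > (0 : ℝ), ∃ c > (0 : ℝ),
        ∀ t : unitInterval, 1 / 2 ≤ (t : ℝ) → (t : ℝ) < 1 / 2 + δ →
          ∀ n N : ℕ, n₀ ≤ n → 2 * n ≤ N → (1 / 2 < (t : ℝ) → N ≤ charLengthW ε t) →
            c * X t n N ≤ (triSitePercolation t).real (sepFourArm n N)) :
    ∃ ε₁ > (0 : ℝ), ∀ ⦃ε : ℝ⦄, 0 < ε → ε < ε₁ →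
      ∃ r₁ : ℕ, ∀ r₀ ≥ r₁, ∃ n₁ : ℕ, ∃ δ > (0 : ℝ), ∃ c > (0 : ℝ),
        ∀ t : unitInterval, 1 / 2 ≤ (t : ℝ) → (t : ℝ) < 1 / 2 + δ →
          ∀ N : ℕ, n₁ ≤ N → (1 / 2 < (t : ℝ) → N ≤ charLengthW ε t) →
            ∀ v : Site 2, (N : ℤ) < 4 * v 0 → 4 * v 0 < 7 * N → (N : ℤ) < 4 * v 1 → 4 * v 1 < 3 * N →
              c * X t r₀ N ≤
                (triSitePercolation t).real {ω | IsPivotal (triLRCrossing (2 * N) N) v ω} := by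
  obtain ⟨ε₁, hε₁, H⟩ := hsep
  refine ⟨ε₁, hε₁, fun ε hε hεε₁ => ?_⟩
  obtain ⟨n₀, δs, hδs, cs, hcs, Hs⟩ := H hε hεε₁
  -- RSW below Werner's length, and at `1/2`
  obtain ⟨ε', hε', hε'2, hLen⟩ := charLengthW_le_charLength_of_gt hε
  obtain ⟨η, hη, -, hRSW⟩ := exists_pow_le_triLRCrossingProb_below hε' hε'2
  obtain ⟨c₀, hc₀, h0⟩ := tri_rsw_half_holds 2046 (by norm_num)
  set θ : ℝ := min (η ^ 2045) c₀ with hθ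
  have hθ0 : 0 < θ := lt_min (pow_pos hη _) hc₀
  refine ⟨max n₀ 64, fun r₀ hr₀ => ?_⟩
  have hr₀n : n₀ ≤ r₀ := le_trans (le_max_left _ _) hr₀
  have hr₀64 : 64 ≤ r₀ := le_trans (le_max_right _ _) hr₀
  -- the lower bound of each gluing event, and of the four of them
  set g : ℝ := (1 / 4 : ℝ) ^ (pivInnerFinset r₀).card * θ ^ 33 with hg
  have hg0 : 0 < g := by positivity
  set K : ℝ := g * g * (g * g) with hK
  have hK0 : 0 < K := by positivity
  refine ⟨512 * (r₀ + 1), min δs (1 / 4), lt_min hδs (by norm_num), cs * K, mul_pos hcs hK0,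
    fun t ht1 ht2 N hN hNL v hv0 hv0' hv1 hv1' => ?_⟩
  have htδ : (t : ℝ) < 1 / 2 + δs := lt_of_lt_of_le ht2 (by linarith [min_le_left δs (1 / 4)])
  have ht34 : (t : ℝ) < 3 / 4 := by linarith [min_le_right δs (1 / 4)]
  -- the scale `q = ⌊N / 512⌋`
  set q : ℕ := N / 512 with hq
  have hdm := Nat.div_add_mod N 512
  have hml := Nat.mod_lt N (by norm_num : 512 > 0)
  have hqN : 512 * q ≤ N := by omega
  have hNq : N < 512 * (q + 1) := by omega
  have hq65 : r₀ + 1 ≤ q := by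
    rw [hq]; exact (Nat.le_div_iff_mul_le (by norm_num)).2 (by linarith)
  have hq1 : 1 ≤ q := by omega
  have hr₀q : r₀ ≤ 64 * q := by omega
  have h2r₀ : 2 * r₀ ≤ 64 * q := by omega
  have h64N : 64 * q ≤ N := by omega
  -- the site as a pair of naturals
  obtain ⟨a, ha⟩ : ∃ a : ℕ, v 0 = a := ⟨(v 0).toNat, (Int.toNat_of_nonneg (by omega)).symm⟩
  obtain ⟨b, hb⟩ : ∃ b : ℕ, v 1 = b := ⟨(v 1).toNat, (Int.toNat_of_nonneg (by omega)).symm⟩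
  rw [ha] at hv0 hv0'
  rw [hb] at hv1 hv1'
  have ha1 : N < 4 * a := by exact_mod_cast hv0
  have ha2 : 4 * a < 7 * N := by exact_mod_cast hv0'
  have hb1 : N < 4 * b := by exact_mod_cast hv1
  have hb2 : 4 * b < 3 * N := by exact_mod_cast hv1'
  have hv : v = ![(a : ℤ), (b : ℤ)] := by
    ext j; fin_cases j
    · simpa using ha
    · simpa using hb
  subst hv
  -- (1) the deterministic inclusion and translation invariance
  have hincl : {ω : SiteConfig (Site 2) |
      SiteConfig.relabel (triShiftIso (-(![(a : ℤ), (b : ℤ)] : Site 2))).toEquiv ω ∈ pivEvent q r₀ N a b} ⊆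
      {ω | IsPivotal (triLRCrossing (2 * N) N) ![(a : ℤ), (b : ℤ)] ω} :=
    fun ω hω => isPivotal_of_pivEvent hq1 hr₀64 hr₀q hqN ha1 ha2 hb1 hb2 hω
  have step1 : (triSitePercolation t).real (pivEvent q r₀ N a b) ≤
      (triSitePercolation t).real {ω | IsPivotal (triLRCrossing (2 * N) N) ![(a : ℤ), (b : ℤ)] ω} := by
    rw [← real_setOf_relabel_shift_mem t (![(a : ℤ), (b : ℤ)]) (pivEvent q r₀ N a b)]
    exact measureReal_mono hincl (measure_ne_top _ _)
  -- (2) Nolin's Lemma 13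
  have step2 := real_pivEvent_ge t hq1 hr₀64 hr₀q (2 * N - a) a (N - b) b
  -- (3) the gluing events
  have hquarter : ∀ p : unitInterval, (p = t ∨ p = σ t) → (1 / 4 : ℝ) ≤ p := by
    rintro p (rfl | rfl)
    · linarith
    · rw [unitInterval.coe_symm_eq]; linarith
  have hslab : ∀ D : ℕ, D ≤ 2 * N → ∀ p : unitInterval, (p = t ∨ p = σ t) → ∀ k : ℕ, k < 33 →
      θ ≤ (triSitePercolation p).real (triHCross (64 * (q : ℤ) + 1) ((-48 + (k : ℤ)) * q) D q) := by
    intro D hD p hp k _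
    rw [triSitePercolation_real_triHCross]
    have hDq : D ≤ 2046 * q := by omega
    have hanti : triLRCrossingProb p (2046 * q) q ≤ triLRCrossingProb p D q :=
      triLRCrossingProb_anti_width p hDq q
    refine le_trans ?_ hanti
    rcases eq_or_lt_of_le ht1 with heq | hgt
    · -- `t = 1/2`
      have ht : t = half := Subtype.ext (by rw [coe_half]; exact heq.symm)
      have hp' : p = half := by
        rcases hp with rfl | rfl
        · exact ht
        · rw [ht, symm_half]
      have hfl : ⌊(2046 : ℝ) * q⌋₊ = 2046 * q := by
        have : (2046 : ℝ) * q = ((2046 * q : ℕ) : ℝ) := by push_cast; ring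
        rw [this, Nat.floor_natCast]
      have := (h0 q (by rw [hfl]; omega)).1
      rw [hfl] at this
      rw [hp']
      exact (min_le_right _ _).trans this
    · -- `t > 1/2`: below Nolin's length
      have hqL : q < charLength ε' t :=
        lt_of_lt_of_le (by omega : q < N) ((hNL hgt).trans (hLen t hgt ht34))
      have hpmin : min t (σ t) ≤ p := by
        rcases hp with rfl | rfl
        · exact min_le_left _ _
        · exact min_le_right _ _
      have := hRSW t p hpmin q hq1 hqL 2045 (2046 * q) (by norm_num) (by omega)
      exact (min_le_left _ _).trans this
  have hglue : ∀ D : ℕ, D ≤ 2 * N → ∀ p : unitInterval, (p = t ∨ p = σ t) →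
      g ≤ (triSitePercolation p).real (pivFrameEvent q r₀ D) := by
    intro D hD p hp
    calc g = (1 / 4 : ℝ) ^ (pivInnerFinset r₀).card * θ ^ 33 := rfl
      _ ≤ (p : ℝ) ^ (pivInnerFinset r₀).card * θ ^ 33 :=
          mul_le_mul_of_nonneg_right (pow_le_pow_left₀ (by norm_num) (hquarter p hp) _) (by positivity)
      _ ≤ _ := real_pivFrameEvent_ge p r₀ hθ0.le (hslab D hD p hp)
  have g0 : g ≤ (triSitePercolation t).real (pivHalfGlue 0 true q r₀ (2 * N - a)) := by
    rw [real_pivHalfGlue_true]; exact hglue _ (by omega) t (Or.inl rfl)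
  have g3 : g ≤ (triSitePercolation t).real (pivHalfGlue 3 true q r₀ a) := by
    rw [real_pivHalfGlue_true]; exact hglue _ (by omega) t (Or.inl rfl)
  have g1 : g ≤ (triSitePercolation t).real (pivHalfGlue 1 false q r₀ (N - b)) := by
    rw [real_pivHalfGlue_false]; exact hglue _ (by omega) (σ t) (Or.inr rfl)
  have g4 : g ≤ (triSitePercolation t).real (pivHalfGlue 4 false q r₀ b) := by
    rw [real_pivHalfGlue_false]; exact hglue _ (by omega) (σ t) (Or.inr rfl)
  have hKle : K ≤ ((triSitePercolation t).real (pivHalfGlue 0 true q r₀ (2 * N - a)) *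
        (triSitePercolation t).real (pivHalfGlue 3 true q r₀ a)) *
      ((triSitePercolation t).real (pivHalfGlue 1 false q r₀ (N - b)) *
        (triSitePercolation t).real (pivHalfGlue 4 false q r₀ b)) :=
    mul_le_mul (mul_le_mul g0 g3 hg0.le measureReal_nonneg) (mul_le_mul g1 g4 hg0.le measureReal_nonneg)
      (by positivity) (mul_nonneg measureReal_nonneg measureReal_nonneg)
  -- (4) separation at the scales `(r₀, 64q)` and monotonicity in the outer radius
  have hsepb := Hs t ht1 htδ r₀ (64 * q) hr₀n h2r₀ (fun hgt => le_trans h64N (hNL hgt))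
  have hmono : X t r₀ N ≤ X t r₀ (64 * q) := hXa t r₀ (64 * q) N hr₀q h64N
  -- (5) the chain
  calc cs * K * X t r₀ N
      ≤ cs * K * X t r₀ (64 * q) := mul_le_mul_of_nonneg_left hmono (by positivity)
    _ = cs * X t r₀ (64 * q) * K := by ring
    _ ≤ (triSitePercolation t).real (sepFourArm r₀ (64 * q)) * K := mul_le_mul_of_nonneg_right hsepb hK0.le
    _ ≤ (triSitePercolation t).real (sepFourArm r₀ (64 * q)) *
          (((triSitePercolation t).real (pivHalfGlue 0 true q r₀ (2 * N - a)) *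
              (triSitePercolation t).real (pivHalfGlue 3 true q r₀ a)) *
            ((triSitePercolation t).real (pivHalfGlue 1 false q r₀ (N - b)) *
              (triSitePercolation t).real (pivHalfGlue 4 false q r₀ b))) :=
        mul_le_mul_of_nonneg_left hKle measureReal_nonneg
    _ ≤ (triSitePercolation t).real (pivEvent q r₀ N a b) := step2
    _ ≤ _ := step1


/-- **The lower bound of Lemma 6.2, general kernel** (the tree's `paraPivotalSum_lower_of_fact` for a
kernel `X ≥ 0`; proof verbatim): the `N · ⌊N/8⌋ ≥ N²/16` interior sites each contribute
`≥ c X_t(r₀, N)`, so `c/16 · N² X_t(r₀, N) ≤ paraPivotalSum t N`. [cite: WernerPCMI2009, Lecture 6, proof of Lemma 6.2 (lower bound)] -/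
theorem paraPivotalSum_lower_gen {X : unitInterval → ℕ → ℕ → ℝ} (hX0 : ∀ t r R, 0 ≤ X t r R)
    (hP : ∃ ε₁ > (0 : ℝ), ∀ ⦃ε : ℝ⦄, 0 < ε → ε < ε₁ →
      ∃ r₁ : ℕ, ∀ r₀ ≥ r₁, ∃ n₁ : ℕ, ∃ δ > (0 : ℝ), ∃ c > (0 : ℝ),
        ∀ t : unitInterval, 1 / 2 ≤ (t : ℝ) → (t : ℝ) < 1 / 2 + δ →
          ∀ N : ℕ, n₁ ≤ N → (1 / 2 < (t : ℝ) → N ≤ charLengthW ε t) →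
            ∀ v : Site 2, (N : ℤ) < 4 * v 0 → 4 * v 0 < 7 * N → (N : ℤ) < 4 * v 1 → 4 * v 1 < 3 * N →
              c * X t r₀ N ≤
                (triSitePercolation t).real {ω | IsPivotal (triLRCrossing (2 * N) N) v ω}) :
    ∃ ε₁ > (0 : ℝ), ∀ ⦃ε : ℝ⦄, 0 < ε → ε < ε₁ →
      ∃ r₁ : ℕ, ∀ r₀ ≥ r₁, ∃ n₁ : ℕ, ∃ δ > (0 : ℝ), ∃ c > (0 : ℝ),
        ∀ t : unitInterval, 1 / 2 ≤ (t : ℝ) → (t : ℝ) < 1 / 2 + δ →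
          ∀ N : ℕ, n₁ ≤ N → (1 / 2 < (t : ℝ) → N ≤ charLengthW ε t) →
            c * ((N : ℝ) ^ 2 * X t r₀ N) ≤ paraPivotalSum t N := by
  classical
  obtain ⟨ε₁, hε₁, H⟩ := hP
  refine ⟨ε₁, hε₁, fun ε hε hε' => ?_⟩
  obtain ⟨r₁, H⟩ := H hε hε'
  refine ⟨r₁, fun r₀ hr₀ => ?_⟩
  obtain ⟨n₁, δ, hδ, c, hc, H⟩ := H r₀ hr₀
  refine ⟨max n₁ 16, δ, hδ, c / 16, by positivity, fun t ht htδ N hN hNL => ?_⟩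
  have hN1 : n₁ ≤ N := (le_max_left _ _).trans hN
  have hN16 : 16 ≤ N := (le_max_right _ _).trans hN
  have Ht := H t ht htδ N hN1 hNL
  set e : ℕ × ℕ → Site 2 := fun p => ![(p.1 : ℤ), (p.2 : ℤ)] with he
  set S : Finset (ℕ × ℕ) :=
    Finset.Ico (N / 4 + 1) (N / 4 + 1 + N) ×ˢ Finset.Ico (N / 4 + 1) (N / 4 + 1 + N / 8) with hS
  have hSsub : S.image e ⊆ rectangle (2 * N) N := by
    intro v hv
    rw [Finset.mem_image] at hv
    obtain ⟨⟨a, b⟩, hab, rfl⟩ := hv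
    rw [hS, Finset.mem_product, Finset.mem_Ico, Finset.mem_Ico] at hab
    rw [mem_rectangle_iff]
    simp only [he, Matrix.cons_val_zero, Matrix.cons_val_one]
    push_cast
    omega
  have hcard : (S.card : ℝ) = N * (N / 8 : ℕ) := by
    rw [hS, Finset.card_product, Nat.card_Ico, Nat.card_Ico]
    push_cast
    have h1 : N / 4 + 1 + N - (N / 4 + 1) = N := by omega
    have h2 : N / 4 + 1 + N / 8 - (N / 4 + 1) = N / 8 := by omega
    rw [h1, h2]
  have hsite : ∀ p ∈ S, c * X t r₀ N ≤
      (triSitePercolation t).real {ω | IsPivotal (triLRCrossing (2 * N) N) (e p) ω} := by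
    rintro ⟨a, b⟩ hab
    rw [hS, Finset.mem_product, Finset.mem_Ico, Finset.mem_Ico] at hab
    apply Ht
    all_goals simp only [he, Matrix.cons_val_zero, Matrix.cons_val_one]; omega
  have hN8 : (N : ℝ) / 16 ≤ ((N / 8 : ℕ) : ℝ) := by
    have h : N ≤ 16 * (N / 8) := by omega
    have h' : (N : ℝ) ≤ 16 * ((N / 8 : ℕ) : ℝ) := by exact_mod_cast h
    rw [div_le_iff₀ (by norm_num : (0 : ℝ) < 16)]
    linarith
  have hπ0 : 0 ≤ X t r₀ N := hX0 t r₀ N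
  calc c / 16 * ((N : ℝ) ^ 2 * X t r₀ N)
      = (N * ((N : ℝ) / 16)) * (c * X t r₀ N) := by ring
    _ ≤ (N * ((N / 8 : ℕ) : ℝ)) * (c * X t r₀ N) := by
        apply mul_le_mul_of_nonneg_right _ (by positivity)
        exact mul_le_mul_of_nonneg_left hN8 (Nat.cast_nonneg N)
    _ = ∑ p ∈ S, c * X t r₀ N := by rw [Finset.sum_const, nsmul_eq_mul, hcard]
    _ ≤ ∑ p ∈ S, (triSitePercolation t).real {ω | IsPivotal (triLRCrossing (2 * N) N) (e p) ω} :=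
        Finset.sum_le_sum hsite
    _ = ∑ v ∈ S.image e, (triSitePercolation t).real {ω | IsPivotal (triLRCrossing (2 * N) N) v ω} :=
        (Finset.sum_image (s := S) (g := e)
          (f := fun v => (triSitePercolation t).real {ω | IsPivotal (triLRCrossing (2 * N) N) v ω})
          (fun p _ q _ h => mkSite_injective h)).symm
    _ ≤ paraPivotalSum t N := by
        rw [paraPivotalSum]
        exact Finset.sum_le_sum_of_subset_of_nonneg hSsub fun _ _ _ => measureReal_nonneg


/-- **Lemma 6.2's lower bound for Werner's alternating `π̂`**: from ALTERNATING near-critical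
separation (`c · π̂^alt_t(n, N) ≤ P_t(sepFourArm n N)` below `L(t, ε)`; Nolin 2008, Thm. 11 for
`σ = BWBW`), for every small `ε` and large `r₀` there are `n₁`, `δ > 0`, `c > 0` with
`c · N² π̂^alt_t(r₀, N) ≤ paraPivotalSum t N` for `1/2 ≤ t < 1/2 + δ`, `n₁ ≤ N`, `N ≤ L(t, ε)` if
`t > 1/2`. [cite: WernerPCMI2009, Lecture 6, proof of Lemma 6.2 (lower bound)] [cite: Nolin2008, Thm. 11 and proof of Prop. 32 (arXiv 0711.4948: Thm. 10, Prop. 31)] -/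
theorem paraPivotalSum_lower_alt_of_altSeparation
    (hsepA : ∃ ε₁ > (0 : ℝ), ∀ ⦃ε : ℝ⦄, 0 < ε → ε < ε₁ →
      ∃ n₀ : ℕ, ∃ δ > (0 : ℝ), ∃ c > (0 : ℝ),
        ∀ t : unitInterval, 1 / 2 ≤ (t : ℝ) → (t : ℝ) < 1 / 2 + δ →
          ∀ n N : ℕ, n₀ ≤ n → 2 * n ≤ N → (1 / 2 < (t : ℝ) → N ≤ charLengthW ε t) →
            c * altFourArmProbAt t n N ≤ (triSitePercolation t).real (sepFourArm n N)) :
    ∃ ε₁ > (0 : ℝ), ∀ ⦃ε : ℝ⦄, 0 < ε → ε < ε₁ →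
      ∃ r₁ : ℕ, ∀ r₀ ≥ r₁, ∃ n₁ : ℕ, ∃ δ > (0 : ℝ), ∃ c > (0 : ℝ),
        ∀ t : unitInterval, 1 / 2 ≤ (t : ℝ) → (t : ℝ) < 1 / 2 + δ →
          ∀ N : ℕ, n₁ ≤ N → (1 / 2 < (t : ℝ) → N ≤ charLengthW ε t) →
            c * ((N : ℝ) ^ 2 * altFourArmProbAt t r₀ N) ≤ paraPivotalSum t N :=
  paraPivotalSum_lower_gen (X := fun t r R => altFourArmProbAt t r R) (fun t r R => altFourArmProbAt_nonneg t r R)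
    (pivotal_lowerBound_of_separation_gen (X := fun t r R => altFourArmProbAt t r R)
      (fun t r _ _ h h' => altFourArmProbAt_anti t r h h') hsepA)

end Literature.Probability.Percolation
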